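import Summits.HodgeConjecture.HodgeConjecture.Theorems.NikulinTwinTransportTwinSimilitudeAlgebraicHKTargetTheorem
import Summits.HodgeConjecture.HodgeConjecture.Theorems.NikulinTwinTransportAlgebraicClassesOneOneK3Proof
import Summits.HodgeConjecture.HodgeConjecture.Theorems.EndoscopicMiddleDegreeCupProductAlgebraicOfChernCharacter
import Literature.AlgebraicGeometry.HodgeTheory.ComplexConjugationHolds
import HarnessLib

/-!
# Route NikulinTwinTransport · crux X = `TwinSimilitudeAlgebraic` (stmt-HodgeConjecture-13674) —
# the HK-Nikulin sector theorems FROM NAMED PUBLISHED FACTS ONLY (reshape r8, lead c3)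

The sector theorem (`twinSimilitudeAlgebraic_onHKSector`, p118113) and the target theorem
(`twinSimilitudeAlgebraic_onHKSectorTargets` / `_onHKSector_either` / `_of_offHKSectorPairs`, p120140) of
line `hyperkaehler-nikulin-anchors` prove X for every pair of projective K3 surfaces one of which lies in
the HK-Nikulin sector, granted (i) the named Literature facts (K3 markings; the four hyperkähler facts
F1–F4), (ii) the support item `CupProductAlgebraic` of ANOTHER route (EndoscopicMiddleDegree,
stmt-HodgeConjecture-14350: `Nˡ ∪ Nᵏ ⊆ N^{l+k}`), (iii) Buskin `HodgeIsometryAlgebraic` (13675),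
`LefschetzOneOneK3` (13678) and `AlgebraicClassesOneOneK3` (15041, CLOSED in the tree).

This file removes (ii) and the closed (iii)-item from the hypotheses: item 14350 is DERIVED in the tree
from ONE named published fact, Voisin I Thm. 11.32 ⊗ ℂ
(`span_holomorphicBundleChernCharacter_eq_algebraicClasses`: on a smooth projective `X/ℂ` the `ℂ`-span
of the Chern characters of holomorphic bundles is `Nᵖ H²ᵖ`) by `cupProductAlgebraic_of_span_chernCharacter`
(file `EndoscopicMiddleDegreeCupProductAlgebraicOfChernCharacter`, p83634: exterior products are algebraic
unconditionally, the diagonal pull-back preserves Chern-character spans by the naturality of Chern–Weil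
forms), whose second input — the existence of Hodge models, `nonempty_hodgeModel` — is DISCHARGED in the
tree (`nonempty_hodgeModel_holds`, file `ComplexConjugationHolds`); and `AlgebraicClassesOneOneK3` enters by
its proof `algebraicClassesOneOneK3_proof`.  Result: X on the HK-Nikulin sector (either twin), and X from
the declared residual `OffSectorPairs`, granted ONLY named published facts (marking existence, F1–F4,
Voisin I 11.32) and the two open items of THIS route that X is designed to lean on (Buskin 13675,
Lefschetz `(1,1)` 13678).  The assessments of item 14350 by its own seats recommend restating it to the
divisor case `k = 1`; this line instantiates it at `(l,k) = (2,2)` on sixfolds and eightfolds, so the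
decoupling also protects the line's deliverable from that restatement.

* `cupProductAlgebraic_of_chernCharacterSpan` — item 14350's statement from Voisin I 11.32 ⊗ ℂ alone.
* `twinSimilitudeAlgebraic_onHKSector_either_of_namedFacts` — X whenever either twin is in the sector.
* `twinSimilitudeAlgebraic_of_namedFacts_offHKSectorPairs` — X from the named facts, 13675, 13678 and
  the residual (pairs with BOTH twins off the sector).
* `hkNamedFacts_anchor` — registered anchor (closed form of the last theorem).
-/

noncomputable section

set_option linter.dupNamespace false

open CategoryTheory MonoidalCategory
open scoped Manifold Matrix
open Literature.AlgebraicGeometry.Motives Literature.AlgebraicGeometry.HodgeTheory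
open Literature.AlgebraicGeometry.Surfaces Literature.AlgebraicGeometry.Hyperkaehler Literature.Geometry.Kaehler
open Literature.AlgebraicTopology.SingularHomology
open Summit.HodgeConjecture.HodgeConjecture.Theses.NikulinTwinTransport

namespace Summit.HodgeConjecture.HodgeConjecture.Theorems.NikulinTwinTransport

/-! ## Local notations (verbatim those of the route's Theorems files) -/

/-- `Gen[S, p]`: `p` is an integral generator of `H⁴(S(ℂ); ℂ)` (the generator clause of X). Local notation
only. -/
local notation3 (prettyPrint := false) "Gen[" S ", " p "]" =>
  (IsIntegralClass p ∧ ∀ q : complexBetti S (2 * 2), IsIntegralClass q → ∃ n : ℤ, q = n • p)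

/-- `Corr[μ, S, S', hS, hS' ; γ, y] = [γ]_* y = fst_*(snd^* y ∪ γ)`, the action of
`γ ∈ H⁴((S ⊗ S′)(ℂ); ℂ)` as a correspondence `H²(S′) → H²(S)` (the FIRST factor receives). Local notation
only, verbatim from the route's Theorems files. -/
local notation3 (prettyPrint := false) "Corr[" μ ", " S ", " S' ", " hS ", " hS' " ; " γ ", " y "]" =>
  complexGysin μ
    (IsSmoothProjective.tensor_holds (IsK3Surface.isSmoothProjective hS)
      (IsK3Surface.isSmoothProjective hS'))
    (IsK3Surface.isSmoothProjective hS) (SemiCartesianMonoidalCategory.fst S S')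
    (rfl : 2 * 1 + 2 * 2 + 2 * 2 = 2 * 1 + 2 * (2 + 2))
    (cupProduct (rfl : 2 * 1 + 2 * 2 = 2 * 1 + 2 * 2)
      (complexBetti.map (SemiCartesianMonoidalCategory.snd S S') (2 * 1) y) γ)

/-- `XBody[μ, S, S', hS, hS', p, p']`: the body of X at one pair after the generator prefix — every rational,
type-preserving `2`-similitude `ψ : H²(S′) → H²(S)` is the action of an algebraic class on `S ⊗ S′`.
Local notation only (verbatim the corresponding segment of the route decl). -/
local notation3 (prettyPrint := false) "XBody[" μ ", " S ", " S' ", " hS ", " hS' ", " p ", " p' "]" =>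
  ∀ (ψ : complexBetti S' (2 * 1) →ₗ[ℂ] complexBetti S (2 * 1)),
    (∀ x, IsRationalClass x → IsRationalClass (ψ x)) →
    (∀ (i j : ℕ) x, IsOfHodgeType 2 S' (2 * 1) i j x → IsOfHodgeType 2 S (2 * 1) i j (ψ x)) →
    (∀ (x y : complexBetti S' (2 * 1)) (a : ℂ),
      cupProduct (rfl : 2 * 1 + 2 * 1 = 2 * 2) x y = a • p' →
        cupProduct (rfl : 2 * 1 + 2 * 1 = 2 * 2) (ψ x) (ψ y) = ((2 : ℂ) * a) • p) →
    ∃ γ ∈ algebraicClasses (MonoidalCategoryStruct.tensorObj S S') 2,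
      ∀ x : complexBetti S' (2 * 1), ψ x = Corr[μ, S, S', hS, hS' ; γ, x]

/-- `OffHKSectorPairs`: the declared residual of the line — X verbatim for pairs with BOTH twins off the
HK-Nikulin sector (the registered stub `stub_offSectorPairs` of the skeleton, symbol for symbol). Local
notation only. -/
local notation3 (prettyPrint := false) "OffHKSectorPairs" =>
  ∀ (μ : OrientationFamily), μ.HasPoincareDuality →
    ∀ (S S' : SchemeOver ℂ) (hS : IsK3Surface S) (hS' : IsK3Surface S')
      (p : complexBetti S (2 * 2)) (p' : complexBetti S' (2 * 2)), Gen[S, p] → Gen[S', p'] →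
      ∀ (ψ : complexBetti S' (2 * 1) →ₗ[ℂ] complexBetti S (2 * 1)),
        (∀ x, IsRationalClass x → IsRationalClass (ψ x)) →
        (∀ (i j : ℕ) x, IsOfHodgeType 2 S' (2 * 1) i j x → IsOfHodgeType 2 S (2 * 1) i j (ψ x)) →
        (∀ (x y : complexBetti S' (2 * 1)) (a : ℂ),
          cupProduct (rfl : 2 * 1 + 2 * 1 = 2 * 2) x y = a • p' →
            cupProduct (rfl : 2 * 1 + 2 * 1 = 2 * 2) (ψ x) (ψ y) = ((2 : ℂ) * a) • p) →
        ¬ InHKNikulinSector S' → ¬ InHKNikulinSector S →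
        ∃ γ ∈ algebraicClasses (MonoidalCategoryStruct.tensorObj S S') 2,
          ∀ x : complexBetti S' (2 * 1), ψ x = Corr[μ, S, S', hS, hS' ; γ, x]

/-! ## Item 14350 from Voisin I Thm. 11.32 ⊗ ℂ alone -/

/-- **`CupProductAlgebraic` (support item stmt-HodgeConjecture-14350 of route EndoscopicMiddleDegree:
`Nˡ H²ˡ ∪ Nᵏ H²ᵏ ⊆ N^{l+k} H^{2(l+k)}` on every smooth projective `X/ℂ`) from ONE named published fact** —
Voisin I Thm. 11.32 tensored with `ℂ` (the `ℂ`-span of the Chern characters of holomorphic bundles is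
`Nᵖ H²ᵖ`): the tree's `cupProductAlgebraic_of_span_chernCharacter` (exterior products are algebraic, the
diagonal pull-back preserves Chern-character spans) with its Hodge-model input discharged
(`nonempty_hodgeModel_holds`).  CONDITIONAL on the named fact; it does not close item 14350.
[cite: VoisinHodgeI2002, Thm. 11.32] [cite: VoisinHodgeII2003, §9.2.4 Prop. 9.20]
[cite: Deligne2000, §2 Remark (ii)] -/
theorem cupProductAlgebraic_of_chernCharacterSpan
    (hV : span_holomorphicBundleChernCharacter_eq_algebraicClasses) :
    Summit.HodgeConjecture.HodgeConjecture.Theses.EndoscopicMiddleDegree.CupProductAlgebraic :=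
  Summit.HodgeConjecture.HodgeConjecture.Theorems.EndoscopicMiddleDegree.cupProductAlgebraic_of_span_chernCharacter
    hV (fun _ _ => nonempty_hodgeModel_holds)

/-! ## The sector theorems from named facts only -/

/-- **X WHENEVER EITHER TWIN LIES IN THE HK-NIKULIN SECTOR, from named published facts and the two open
items of this route only**: for projective K3 surfaces `S, S′` with `S′` or `S` in the sector
(`T_ℚ ↪ (U³ ⊕ E₈(−2) ⊕ ⟨−2⟩)_ℚ`), every rational, type-preserving `2`-similitude
`ψ : H²(S′(ℂ); ℂ) → H²(S(ℂ); ℂ)` is `fst_*(snd^* – ∪ γ)` for an algebraic `γ` on `S × S′` — granted the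
named facts (`Huybrechts_K3_marking_exists`, F1 `CamereEtAl2026_symplecticInvolution_periodSurjective`, F2
`CamereEtAl2023_fixedK3_restriction`, F3 `Markman2024_rationalHodgeIsometry_algebraic_marked`, F4
`Beauville1983_hilbertSquare_markedIncidence`, and Voisin I Thm. 11.32 ⊗ ℂ
`span_holomorphicBundleChernCharacter_eq_algebraicClasses`), Buskin's theorem `HodgeIsometryAlgebraic`
(13675) and `LefschetzOneOneK3` (13678).  The cup-product item 14350 and the closed item 15041 enter by
their proofs. [cite: CamereEtAl2026, Thm. 1.2 and Thm. 5.12] [cite: Markman2024, Thm. 1.1]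
[cite: Varesco2023, Thm. 2.1 and Prop. 2.5] [cite: Buskin2019, Thm. 1.1] [cite: VoisinHodgeI2002, Thm. 11.32] -/
theorem twinSimilitudeAlgebraic_onHKSector_either_of_namedFacts
    (h₀ : (Huybrechts_K3_marking_exists ∧ CamereEtAl2026_symplecticInvolution_periodSurjective ∧
        CamereEtAl2023_fixedK3_restriction ∧ Markman2024_rationalHodgeIsometry_algebraic_marked ∧
        Beauville1983_hilbertSquare_markedIncidence))
    (hV : span_holomorphicBundleChernCharacter_eq_algebraicClasses)
    (hB : HodgeIsometryAlgebraic) (hL : LefschetzOneOneK3)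
    {μ : OrientationFamily} (hμ : μ.HasPoincareDuality)
    (S S' : SchemeOver ℂ) (hS : IsK3Surface S) (hS' : IsK3Surface S')
    (p : complexBetti S (2 * 2)) (p' : complexBetti S' (2 * 2)) (hp : Gen[S, p]) (hp' : Gen[S', p'])
    (hsec : InHKNikulinSector S' ∨ InHKNikulinSector S) :
    XBody[μ, S, S', hS, hS', p, p'] :=
  twinSimilitudeAlgebraic_onHKSector_either h₀ (cupProductAlgebraic_of_chernCharacterSpan hV) hB hL
    algebraicClassesOneOneK3_proof hμ S S' hS hS' p p' hp hp' hsec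

/-- **X from the named facts, the two open items of this route and the declared residual** (pairs with
BOTH twins off the sector — the registered stub `stub_offSectorPairs` of line `hyperkaehler-nikulin-anchors`,
an open sub-case of the Hodge conjecture for `S × S′`): a CONDITIONAL proof of the route's crux
`TwinSimilitudeAlgebraic` in which no item of another route occurs. [cite: Varesco2023, Thm. 2.1 and Prop. 2.5]
[cite: CamereEtAl2026, Thm. 1.2] [cite: VoisinHodgeI2002, Thm. 11.32] -/
theorem twinSimilitudeAlgebraic_of_namedFacts_offHKSectorPairs
    (h₀ : (Huybrechts_K3_marking_exists ∧ CamereEtAl2026_symplecticInvolution_periodSurjective ∧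
        CamereEtAl2023_fixedK3_restriction ∧ Markman2024_rationalHodgeIsometry_algebraic_marked ∧
        Beauville1983_hilbertSquare_markedIncidence))
    (hV : span_holomorphicBundleChernCharacter_eq_algebraicClasses)
    (hB : HodgeIsometryAlgebraic) (hL : LefschetzOneOneK3) (hoff : OffHKSectorPairs) :
    Summit.HodgeConjecture.HodgeConjecture.Theses.NikulinTwinTransport.TwinSimilitudeAlgebraic := by
  intro μ hμ S S' hS hS' p p' hp hp' ψ hψr hψt hψs
  by_cases hsec : InHKNikulinSector S' ∨ InHKNikulinSector S
  · exact twinSimilitudeAlgebraic_onHKSector_either_of_namedFacts h₀ hV hB hL hμ S S' hS hS' p p' hp hp'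
      hsec ψ hψr hψt hψs
  · exact hoff μ hμ S S' hS hS' p p' hp hp' ψ hψr hψt hψs (fun h => hsec (Or.inl h))
      (fun h => hsec (Or.inr h))

/-- Registered anchor of this file: closed form of `twinSimilitudeAlgebraic_of_namedFacts_offHKSectorPairs` —
X from the named facts (markings, F1–F4, Voisin I 11.32 ⊗ ℂ), Buskin (13675), `LefschetzOneOneK3` (13678)
and the declared residual (pairs with both twins off the sector). [cite: Varesco2023, Thm. 2.1 and Prop. 2.5]
[cite: CamereEtAl2026, Thm. 1.2] [cite: VoisinHodgeI2002, Thm. 11.32] -/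
theorem hkNamedFacts_anchor :
    (Huybrechts_K3_marking_exists ∧ CamereEtAl2026_symplecticInvolution_periodSurjective ∧
        CamereEtAl2023_fixedK3_restriction ∧ Markman2024_rationalHodgeIsometry_algebraic_marked ∧
        Beauville1983_hilbertSquare_markedIncidence) →
    span_holomorphicBundleChernCharacter_eq_algebraicClasses →
    HodgeIsometryAlgebraic → LefschetzOneOneK3 → OffHKSectorPairs →
    Summit.HodgeConjecture.HodgeConjecture.Theses.NikulinTwinTransport.TwinSimilitudeAlgebraic :=
  fun h₀ hV hB hL hoff => twinSimilitudeAlgebraic_of_namedFacts_offHKSectorPairs h₀ hV hB hL hoff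

end Summit.HodgeConjecture.HodgeConjecture.Theorems.NikulinTwinTransport

end
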